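import Literature.NumberTheory.EllipticCurves.LocalFrobeniusGenerationProofs
import Literature.NumberTheory.EllipticCurves.UnramifiedLayerRootsProofs
import Literature.NumberTheory.GaloisRepresentations.CyclicQuotientTwoCocycle
import Literature.NumberTheory.GaloisRepresentations.AbsGaloisGroupCompact
import HarnessLib

/-!
# Continuous `2`-cocycles of `Γ_{K_v}` inflated from the unramified quotient with finite torsion
# coefficients are coboundaries (`H²(K_v^{nr}/K_v, A) = 0` at finite level)

`Proofs`-style file (theorems only, no definitions, **no named fact**, D-0026) in topic
`NumberTheory/EllipticCurves`, next to its inputs (`LocalFrobeniusGenerationProofs`,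
`UnramifiedLayerRootsProofs`, which phrase the local objects of the tree: for a number field `K` and
a finite place `v`, the absolute Galois group `Γ = Γ_{K_v} = Gal(K̄_v/K_v)` of the completion, the
prime `𝔐` of the local absolute integers above `𝓂_v`, its inertia group `I = I_𝔐 ≤ Γ` and an
arithmetic Frobenius `F`).

**Theorem** (`twoCocycleClass_eq_zero_of_inertia_le`).  Let `X` be a topological representation of
`Γ` whose elements are killed by `N ≠ 0`, and `S ≤ Γ` an open subgroup containing `I` and acting
trivially on `X`.  Every continuous `2`-cocycle `z ∈ Z²_cont(Γ, X)` which is right-`S`-invariant in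
both arguments has trivial class: `[z] = 0` in `H²_cont(Γ, X)`.

Classically: such a `z` is inflated from the finite unramified quotient `Γ/(normal core of S)`,
a cyclic group generated by the Frobenius, and `H²` of the procyclic group `Γ/I ≅ Ẑ` with torsion
coefficients vanishes (`cd Ẑ = 1`; Serre, *Galois Cohomology*, I §3.4 and II §5.2 (`Br(K^{nr}/K)`
computations), Milne, *ADT*, I §2 opening remarks and the proof of Prop. 6.9: the local terms of the
Cassels–Tate pairing vanish where everything is unramified).  The proof here is the explicit
finite-level one of `GaloisRepresentations/CyclicQuotientTwoCocycle`:

1. `H₀ :=` the normal core of `S` is open, normal, contains `I` (which is normal,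
   `inertia_normal_of_mem_localPrimesAbove`); `Γ/H₀ = ⟨F̄⟩` has order `n₀`.
2. Let `ζ ∈ K̄_v` be a primitive `(q^{N n₀} - 1)`-th root of unity (`q = #k_v`): its stabiliser `T`
   is open, contains `I` (`smul_eq_self_of_mem_inertia_of_pow_eq_one`), and `Fʲ ∈ T ↔ N n₀ ∣ j`
   (`frobenius_pow_smul_eq_self_iff`).  Put `H₁ :=` the normal core of `H₀ ∩ T`; then
   `Γ/H₁ = ⟨F̄⟩` (every `σ = Fⁱ τ u`, `τ ∈ I`, `u ∈ H₁`: `exists_eq_frobenius_pow_mul_inertia_mul`)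
   has order `n₁` with `N n₀ ∣ n₁`.
3. The norm sum `∑_{l<n₁} z(Fˡ, F)` equals `(n₁/n₀) • ∑_{l<n₀} z(Fˡ, F)` by `H₀`-periodicity, and
   `N ∣ n₁/n₀` kills it; so `z` is a coboundary by `twoCocycleClass_eq_zero_of_cyclicQuotient`.

Used by `CasselsTateFiniteSupport` (finite support of the local terms of the Cassels–Tate pairing).

## References

* [SerreLocalFields1979] J.-P. Serre, *Local Fields* (1979), Ch. XIII §1 (cohomology of finite cyclic
  groups), Ch. IV §4 and Ch. XII §§1–3 (`K^{nr}`, `H²` of unramified extensions).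
* [MilneADT2006] J. S. Milne, *Arithmetic Duality Theorems*, 2nd ed. (2006), Ch. I §2 (notation
  `G/I ≅ Ẑ`), Ch. I §6, proof of Prop. 6.9.
* [NeukirchSchmidtWingberg2008] J. Neukirch, A. Schmidt, K. Wingberg, *Cohomology of Number Fields*,
  2nd ed. (2008), Ch. I §7 (1.7.1), Ch. VII §1 (7.1.2: `cd` of `Ẑ`-extensions).

## Design

No definitions; `noncomputable section`; one universe `u` (`K : Type u`, as in the files providing the
local objects); the compactness of absolute Galois groups is a local instance only, as in the tree's
cohomology files.
-/

noncomputable section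

open scoped Classical NNReal Topology
open NumberField IsDedekindDomain

universe u

namespace Literature.NumberTheory.EllipticCurves

open Literature.NumberTheory.GaloisRepresentations Field IsDedekindDomain.HeightOneSpectrum

-- Compactness of absolute Galois groups: a local instance only (as in the tree's cohomology files).
attribute [local instance] absoluteGaloisGroup_compactSpace

variable {K : Type u} [Field K] [NumberField K] (v : HeightOneSpectrum (𝓞 K))

/-- **The stabiliser in `Γ_{K_v}` of a root of unity is open** (it contains the open subgroup
`Gal(K̄_v / K_v(ζ))`, `K_v(ζ)/K_v` being finite). [folklore] -/
theorem isOpen_stabilizer_of_pow_eq_one {ζ : AlgebraicClosure (v.adicCompletion K)} {m : ℕ}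
    (hm0 : m ≠ 0) (hζ : ζ ^ m = 1) :
    IsOpen (MulAction.stabilizer (absoluteGaloisGroup (v.adicCompletion K)) ζ :
      Set (absoluteGaloisGroup (v.adicCompletion K))) := by
  haveI := finiteDimensional_adjoin_of_pow_eq_one (v := v) hm0 hζ
  -- the stabiliser contains the Krull neighbourhood `Gal(K̄_v / K_v(ζ))` of `1`
  have hmem : ((MulAction.stabilizer (absoluteGaloisGroup (v.adicCompletion K)) ζ :
      Subgroup (absoluteGaloisGroup (v.adicCompletion K))) : Set (absoluteGaloisGroup (v.adicCompletion K))) ∈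
      𝓝 (1 : absoluteGaloisGroup (v.adicCompletion K)) :=
    (krullTopology_mem_nhds_one_iff (v.adicCompletion K) (AlgebraicClosure (v.adicCompletion K)) _).2
      ⟨IntermediateField.adjoin (v.adicCompletion K) {ζ}, inferInstance, fun σ hσ => by
        rw [SetLike.mem_coe, IntermediateField.mem_fixingSubgroup_iff] at hσ
        change (absoluteGaloisGroup.toAlgEquiv (v.adicCompletion K)).symm σ ∈
          MulAction.stabilizer (absoluteGaloisGroup (v.adicCompletion K)) ζ
        rw [MulAction.mem_stabilizer_iff]
        exact (forall_smul_eq_self_iff_smul_eq hm0 hζ _).mp fun x hx => hσ x hx⟩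
  exact Subgroup.isOpen_of_mem_nhds _ hmem

/-- **`H²(K_v^{nr}/K_v)`-vanishing at finite level.**  Let `K` be a number field, `v` a finite place,
`Γ = Γ_{K_v}`, `𝔐` the prime of the local absolute integers above `𝓂_v` and `I = I_𝔐` its inertia
group.  Let `X` be a topological representation of `Γ` with `N • x = 0` for all `x` (`N ≠ 0`), `S ≤ Γ`
an OPEN subgroup containing `I` and acting trivially on `X`, and `z` a continuous `2`-cocycle of `X`
which is right-`S`-invariant in both arguments.  Then `[z] = 0` in `H²_cont(Γ, X)`: `z` is inflated
from a finite cyclic unramified quotient `⟨F̄⟩` of `Γ`, and after enlarging the level by a factor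
divisible by `N` (adjoining `ζ_{q^{N n₀} - 1}`) its norm-sum class is multiplied by that factor, hence
dies (module docstring, steps 1–3).  This is the cochain form of `H²(Γ/I, A) = 0` for finite `A`
(`cd Ẑ = 1`). [cite: NeukirchSchmidtWingberg2008, Ch. I §7 Prop. (1.7.1) and Ch. VII §1] -/
theorem twoCocycleClass_eq_zero_of_inertia_le {𝔐 : Ideal v.localAbsIntegers}
    (h𝔐 : 𝔐 ∈ v.localPrimesAbove) (X : TopRep.{u} ℤ (absoluteGaloisGroup (v.adicCompletion K)))
    {N : ℕ} (hN : N ≠ 0) (hNX : ∀ x : X, N • x = 0)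
    (S : Subgroup (absoluteGaloisGroup (v.adicCompletion K)))
    (hS : IsOpen (S : Set (absoluteGaloisGroup (v.adicCompletion K))))
    (hIS : 𝔐.inertia (absoluteGaloisGroup (v.adicCompletion K)) ≤ S)
    (hSX : ∀ s ∈ S, ∀ x : X, X.ρ s x = x)
    (z : contTwoCocycles X)
    (hz₁ : ∀ σ τ : absoluteGaloisGroup (v.adicCompletion K), ∀ s ∈ S, z.1 (σ * s, τ) = z.1 (σ, τ))
    (hz₂ : ∀ σ τ : absoluteGaloisGroup (v.adicCompletion K), ∀ s ∈ S, z.1 (σ, τ * s) = z.1 (σ, τ)) :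
    twoCocycleClass X z = 0 := by
  obtain ⟨F, hF⟩ := exists_isArithFrobAt_localAbsIntegers v h𝔐
  obtain ⟨w, hw⟩ := v.exists_spectralValuation
  haveI hIn : (𝔐.inertia (absoluteGaloisGroup (v.adicCompletion K))).Normal :=
    inertia_normal_of_mem_localPrimesAbove v h𝔐
  -- Step 1: the open normal subgroup `H₀ ⊆ S` containing `I`, and the order `n₀` of `F̄` modulo `H₀`
  haveI : Finite (absoluteGaloisGroup (v.adicCompletion K) ⧸ S) := Subgroup.quotient_finite_of_isOpen S hS
  haveI : S.FiniteIndex := Subgroup.finiteIndex_of_finite_quotient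
  set H₀ : Subgroup (absoluteGaloisGroup (v.adicCompletion K)) := S.normalCore with hH₀
  have hH₀S : H₀ ≤ S := Subgroup.normalCore_le S
  have hIH₀ : 𝔐.inertia (absoluteGaloisGroup (v.adicCompletion K)) ≤ H₀ :=
    Subgroup.normal_le_normalCore.mpr hIS
  have hH₀open : IsOpen (H₀ : Set (absoluteGaloisGroup (v.adicCompletion K))) :=
    Subgroup.isOpen_of_isClosed_of_finiteIndex _
      (Subgroup.normalCore_isClosed S (Subgroup.isClosed_of_isOpen S hS))
  haveI : Finite (absoluteGaloisGroup (v.adicCompletion K) ⧸ H₀) := Subgroup.quotient_finite_of_isOpen H₀ hH₀open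
  set n₀ := orderOf (QuotientGroup.mk F : absoluteGaloisGroup (v.adicCompletion K) ⧸ H₀) with hn₀
  have hn₀pos : 0 < n₀ := orderOf_pos _
  have hFn₀ : F ^ n₀ ∈ H₀ := by
    rw [← QuotientGroup.eq_one_iff, QuotientGroup.mk_pow, hn₀, pow_orderOf_eq_one]
  -- Step 2: a primitive `(q^{N n₀} - 1)`-th root of unity and its open stabiliser `T ⊇ I`
  have hn : N * n₀ ≠ 0 := Nat.mul_ne_zero hN hn₀pos.ne'
  obtain ⟨ζ, hζ⟩ := exists_isPrimitiveRoot_residueCard_pow_sub_one (v := v) hn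
  have hm0 : Nat.card (IsLocalRing.ResidueField (v.adicCompletionIntegers K)) ^ (N * n₀) - 1 ≠ 0 :=
    residueCard_pow_sub_one_ne_zero (v := v) hn
  have hm1 : w ((Nat.card (IsLocalRing.ResidueField (v.adicCompletionIntegers K)) ^ (N * n₀) - 1 : ℕ) :
      AlgebraicClosure (v.adicCompletion K)) = 1 :=
    spectralValuation_natCast_residueCard_pow_sub_one hw hn
  set T : Subgroup (absoluteGaloisGroup (v.adicCompletion K)) :=
    MulAction.stabilizer (absoluteGaloisGroup (v.adicCompletion K)) ζ with hT
  have hTopen : IsOpen (T : Set (absoluteGaloisGroup (v.adicCompletion K))) :=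
    isOpen_stabilizer_of_pow_eq_one v hm0 hζ.pow_eq_one
  have hIT : 𝔐.inertia (absoluteGaloisGroup (v.adicCompletion K)) ≤ T := fun i hi =>
    smul_eq_self_of_mem_inertia_of_pow_eq_one hw h𝔐 hi hm0 hm1 hζ.pow_eq_one
  -- Step 3: the open normal subgroup `H₁ ⊆ H₀ ∩ T` containing `I`, and the order `n₁` of `F̄` modulo `H₁`
  have h01open : IsOpen ((H₀ ⊓ T : Subgroup (absoluteGaloisGroup (v.adicCompletion K))) :
      Set (absoluteGaloisGroup (v.adicCompletion K))) := by
    rw [Subgroup.coe_inf]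
    exact hH₀open.inter hTopen
  haveI : Finite (absoluteGaloisGroup (v.adicCompletion K) ⧸ (H₀ ⊓ T)) := Subgroup.quotient_finite_of_isOpen _ h01open
  haveI : (H₀ ⊓ T).FiniteIndex := Subgroup.finiteIndex_of_finite_quotient
  set H₁ : Subgroup (absoluteGaloisGroup (v.adicCompletion K)) := (H₀ ⊓ T).normalCore with hH₁
  have hH₁le : H₁ ≤ H₀ ⊓ T := Subgroup.normalCore_le _
  have hIH₁ : 𝔐.inertia (absoluteGaloisGroup (v.adicCompletion K)) ≤ H₁ :=
    Subgroup.normal_le_normalCore.mpr (le_inf hIH₀ hIT)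
  have hH₁open : IsOpen (H₁ : Set (absoluteGaloisGroup (v.adicCompletion K))) :=
    Subgroup.isOpen_of_isClosed_of_finiteIndex _
      (Subgroup.normalCore_isClosed _ (Subgroup.isClosed_of_isOpen _ h01open))
  have hH₁S : H₁ ≤ S := hH₁le.trans (inf_le_left.trans hH₀S)
  haveI : Finite (absoluteGaloisGroup (v.adicCompletion K) ⧸ H₁) := Subgroup.quotient_finite_of_isOpen H₁ hH₁open
  set n₁ := orderOf (QuotientGroup.mk F : absoluteGaloisGroup (v.adicCompletion K) ⧸ H₁) with hn₁
  have hFn₁ : F ^ n₁ ∈ H₁ := by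
    rw [← QuotientGroup.eq_one_iff, QuotientGroup.mk_pow, hn₁, pow_orderOf_eq_one]
  -- divisibilities `n₀ ∣ n₁` and `N n₀ ∣ n₁`
  have hdvd₀ : n₀ ∣ n₁ := by
    rw [hn₀]
    apply orderOf_dvd_of_pow_eq_one
    rw [← QuotientGroup.mk_pow, QuotientGroup.eq_one_iff]
    exact (inf_le_left : H₀ ⊓ T ≤ H₀) (hH₁le hFn₁)
  have hdvd : N * n₀ ∣ n₁ := by
    have hT₁ : F ^ n₁ ∈ T := (inf_le_right : H₀ ⊓ T ≤ T) (hH₁le hFn₁)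
    exact (frobenius_pow_smul_eq_self_iff hw h𝔐 hF hn hζ n₁).mp hT₁
  -- Step 4: the norm sum over one period of `F̄` modulo `H₁` vanishes
  obtain ⟨k, hk⟩ := hdvd₀
  have hNk : N ∣ k := by
    obtain ⟨t, ht⟩ := hdvd
    refine ⟨t, Nat.eq_of_mul_eq_mul_left hn₀pos ?_⟩
    rw [← hk, ht]
    ring
  have hsum : frobSum z F n₁ = 0 := by
    rw [hk]
    exact frobSum_eq_zero_of_dvd (fun σ τ h hh => hz₁ σ τ h (hH₀S hh)) hFn₀ hNX hNk
  -- Step 5: `Γ ⧸ H₁ = ⟨F̄⟩` and conclusion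
  have hgen : ∀ qq : absoluteGaloisGroup (v.adicCompletion K) ⧸ H₁, ∃ i : ℕ,
      qq = (QuotientGroup.mk F : absoluteGaloisGroup (v.adicCompletion K) ⧸ H₁) ^ i := by
    intro qq
    obtain ⟨σ, rfl⟩ := QuotientGroup.mk_surjective qq
    obtain ⟨i, τ, u, hτ, hu, rfl⟩ := exists_eq_frobenius_pow_mul_inertia_mul v h𝔐 hF hH₁open σ
    refine ⟨i, ?_⟩
    rw [QuotientGroup.mk_mul, QuotientGroup.mk_mul, (QuotientGroup.eq_one_iff τ).mpr (hIH₁ hτ),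
      (QuotientGroup.eq_one_iff u).mpr hu, mul_one, mul_one, QuotientGroup.mk_pow]
  exact twoCocycleClass_eq_zero_of_cyclicQuotient H₁ F z hgen hH₁open
    (fun σ τ h hh => hz₁ σ τ h (hH₁S hh)) (fun σ τ h hh => hz₂ σ τ h (hH₁S hh))
    (fun h hh x => hSX h (hH₁S hh) x) hsum

end Literature.NumberTheory.EllipticCurves

end
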